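import Summits.KontsevichZagierPeriods.KontsevichZagierPeriods.Theorems.FurushoPentagonPentagonInKZCornerReps
import Literature.NumberTheory.Transcendental.KZDominatedFamilyRelations
import Literature.NumberTheory.Transcendental.NashCubes
import Literature.NumberTheory.Transcendental.SemialgebraicLineDeriv
import Literature.NumberTheory.Transcendental.Associators

/-!
# `PentagonInKZ`, line `edge-normal-newton-leibniz`: corner engine — edge values of the defect

Part of the proof of `cornerEngine_uniformlyNull` (crux `FurushoPentagon.PentagonInKZ`,
stmt-KontsevichZagierPeriods-11348), in the ABSTRACT form of the corner engine: all objects (residues `Zq`,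
residue monomials `wZ`, letter densities `fd`, `gd`, `dd`, regularised word integrands `Ht`, `Vt`,
`dHt`, `dVt`, insertion operators `op`, `opV`, transports `Af`, `Bf`, `dAf`, `dBf`, defect
`F = Af − Bf`, coordinate blocks `Xb | Yb | Θb`) are hypothesised, and their properties form ONE
hypothesis bundle `H`.  This file records the EXACT (pointwise on the closed cube, no analysis)
consequences of the edge values `Ht nil = Vt nil = 1`, `dVt nil = 0`, `Ht U x 0 η = 0` (`k ≥ 1`),
`Vt V y ξ 0 = 0` (`l ≥ 1`), `fd ℓ t y = 1/t`, `dd ℓ' = 0`: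

* `edges_Bf_nil`, `edges_Af_nil`, `edges_Af_height_zero`, `edges_Bf_width_zero` — the edge
  values `B_{k,0}(ξ,η) = A_{k,0}(ξ,0)`, `A_{0,l}(ξ,η) = B_{0,l}(0,η)`, `A_{k,l+1}(ξ,0) = 0`,
  `B_{k+1,l}(0,η) = 0` of the two transports;
* `F_axes` — the defect vanishes on both axes;
* `decomp_mid`, `decomp_right`, `decomp_left`, `decomp_zero` — the decomposition
  `F_{k,l}(Ξ,Η) = [k ≥ 1](A(Ξ,Η) − A(Ξ,0)) − [l ≥ 1](B(Ξ,Η) − B(0,Η))` at the level of classes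
  (rule (1): integrand additivity on a common domain);
* `stepA_euler_nil`, `stepA_direct_nil`, `collect_deg1_zero` — three terms of Step A whose
  integrands vanish identically (empty transverse block; the regularised letters).

References: [KontsevichZagier2001, §1.2 rule (1)].
-/

noncomputable section

open Set MeasureTheory
open Literature.NumberTheory.Transcendental
open Literature.ModelTheory.ExponentialFields (IsSemialgebraic)

namespace Summit.KontsevichZagierPeriods.FurushoPentagon.PentagonInKZ

section AbstractEngine

variable {m N : ℕ} {ℓ ℓ' : Fin (m + 2)} {α β : ℚ}
  {Zq : Fin (m + 2) → (DrinfeldKohnoTrunc ℚ (Fin 4) N)} {wZ : ∀ {n : ℕ}, (Fin n → Fin (m + 2)) → (DrinfeldKohnoTrunc ℚ (Fin 4) N)}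
  {fd gd dd : Fin (m + 2) → ℝ → ℝ → ℝ}
  {Ht Vt dHt dVt : ∀ {n : ℕ}, (Fin n → Fin (m + 2)) → (Fin n → ℝ) → ℝ → ℝ → ℝ}
  {op opV : Fin (m + 2) → (DrinfeldKohnoTrunc ℚ (Fin 4) N) →ₗ[ℚ] (DrinfeldKohnoTrunc ℚ (Fin 4) N)}
  {Af Bf dAf dBf F : ((DrinfeldKohnoTrunc ℚ (Fin 4) N) →ₗ[ℚ] ℚ) → ∀ {k l : ℕ}, (Fin k → ℝ) → (Fin l → ℝ) → ℝ → ℝ → ℝ}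
  {Xb : ∀ k l e : ℕ, (Fin (k + l + e) → ℝ) → Fin k → ℝ}
  {Yb : ∀ k l e : ℕ, (Fin (k + l + e) → ℝ) → Fin l → ℝ}
  {Θb : ∀ k l e : ℕ, (Fin (k + l + e) → ℝ) → Fin e → ℝ}

variable (H :
    (∀ {n : ℕ} (U : Fin n → Fin (m + 2)), wZ U = ((List.ofFn U).map Zq).prod) ∧
    (∀ (a : Fin (m + 2)) (X : (DrinfeldKohnoTrunc ℚ (Fin 4) N)), op a X = if a = ℓ then Zq ℓ * X - X * Zq ℓ else Zq a * X) ∧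
    (∀ (b : Fin (m + 2)) (X : (DrinfeldKohnoTrunc ℚ (Fin 4) N)), opV b X = if b = ℓ' then Zq ℓ' * X - X * Zq ℓ' else Zq b * X) ∧
    (∀ (μ : (DrinfeldKohnoTrunc ℚ (Fin 4) N) →ₗ[ℚ] ℚ) {k l : ℕ} (x : Fin k → ℝ) (y : Fin l → ℝ) (ξ η : ℝ), Af μ x y ξ η = ∑ U : Fin k → Fin (m + 2), ∑ V : Fin l → Fin (m + 2), (μ (wZ U * wZ V) : ℝ) * (Ht U x ξ η * Vt V y 0 η)) ∧
    (∀ (μ : (DrinfeldKohnoTrunc ℚ (Fin 4) N) →ₗ[ℚ] ℚ) {k l : ℕ} (x : Fin k → ℝ) (y : Fin l → ℝ) (ξ η : ℝ), Bf μ x y ξ η = ∑ U : Fin k → Fin (m + 2), ∑ V : Fin l → Fin (m + 2), (μ (wZ V * wZ U) : ℝ) * (Vt V y ξ η * Ht U x ξ 0)) ∧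
    (∀ (μ : (DrinfeldKohnoTrunc ℚ (Fin 4) N) →ₗ[ℚ] ℚ) {k l : ℕ} (x : Fin k → ℝ) (y : Fin l → ℝ) (ξ η : ℝ), dAf μ x y ξ η = ∑ U : Fin k → Fin (m + 2), ∑ V : Fin l → Fin (m + 2), (μ (wZ U * wZ V) : ℝ) * (dHt U x ξ η * Vt V y 0 η)) ∧
    (∀ (μ : (DrinfeldKohnoTrunc ℚ (Fin 4) N) →ₗ[ℚ] ℚ) {k l : ℕ} (x : Fin k → ℝ) (y : Fin l → ℝ) (ξ η : ℝ), dBf μ x y ξ η = ∑ U : Fin k → Fin (m + 2), ∑ V : Fin l → Fin (m + 2), (μ (wZ V * wZ U) : ℝ) * (dVt V y ξ η * Ht U x ξ 0)) ∧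
    (∀ (μ : (DrinfeldKohnoTrunc ℚ (Fin 4) N) →ₗ[ℚ] ℚ) {k l : ℕ} (x : Fin k → ℝ) (y : Fin l → ℝ) (ξ η : ℝ), F μ x y ξ η = Af μ x y ξ η - Bf μ x y ξ η) ∧
    (∀ (k l e : ℕ) (z : Fin (k + l + e) → ℝ), Xb k l e z = fun i => z (Fin.castAdd e (Fin.castAdd l i))) ∧
    (∀ (k l e : ℕ) (z : Fin (k + l + e) → ℝ), Yb k l e z = fun j => z (Fin.castAdd e (Fin.natAdd k j))) ∧
    (∀ (k l e : ℕ) (z : Fin (k + l + e) → ℝ), Θb k l e z = fun s => z (Fin.natAdd (k + l) s)) ∧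
    (∀ (U : Fin 0 → Fin (m + 2)) (x : Fin 0 → ℝ) (ξ η : ℝ), Ht U x ξ η = 1) ∧
    (∀ (V : Fin 0 → Fin (m + 2)) (y : Fin 0 → ℝ) (ξ η : ℝ), Vt V y ξ η = 1) ∧
    (∀ (U : Fin 0 → Fin (m + 2)) (x : Fin 0 → ℝ) (ξ η : ℝ), dHt U x ξ η = 0) ∧
    (∀ (V : Fin 0 → Fin (m + 2)) (y : Fin 0 → ℝ) (ξ η : ℝ), dVt V y ξ η = 0) ∧
    (∀ {k : ℕ} (U : Fin (k + 1) → Fin (m + 2)) (x : Fin (k + 1) → ℝ) (η : ℝ), Ht U x 0 η = 0) ∧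
    (∀ {l : ℕ} (V : Fin (l + 1) → Fin (m + 2)) (y : Fin (l + 1) → ℝ) (ξ : ℝ), Vt V y ξ 0 = 0) ∧
    (∀ t y : ℝ, fd ℓ t y = 1 / t) ∧
    (∀ x s : ℝ, gd ℓ' x s = 1 / s) ∧
    (∀ x y : ℝ, dd ℓ x y = 0) ∧
    (∀ x y : ℝ, dd ℓ' x y = 0) ∧
    (∀ (μ : (DrinfeldKohnoTrunc ℚ (Fin 4) N) →ₗ[ℚ] ℚ) {k : ℕ} (x₀ : ℝ) (x' : Fin k → ℝ) (ξ η : ℝ), ∑ U : Fin (k + 1) → Fin (m + 2), (μ (wZ U) : ℝ) * Ht U (Fin.cons x₀ x') ξ η = (∑ a : Fin (m + 2), (if a = ℓ then 1 / x₀ else ξ * fd a (ξ * x₀) η) * ∑ U' : Fin k → Fin (m + 2), (μ (Zq a * wZ U') : ℝ) * Ht U' x' (ξ * x₀) η) - (1 / x₀) * ∑ U' : Fin k → Fin (m + 2), (μ (wZ U' * Zq ℓ) : ℝ) * Ht U' x' (ξ * x₀) η) ∧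
    (∀ (μ : (DrinfeldKohnoTrunc ℚ (Fin 4) N) →ₗ[ℚ] ℚ) {l : ℕ} (y₀ : ℝ) (y' : Fin l → ℝ) (ξ η : ℝ), ∑ V : Fin (l + 1) → Fin (m + 2), (μ (wZ V) : ℝ) * Vt V (Fin.cons y₀ y') ξ η = (∑ b : Fin (m + 2), (if b = ℓ' then 1 / y₀ else η * gd b ξ (η * y₀)) * ∑ V' : Fin l → Fin (m + 2), (μ (Zq b * wZ V') : ℝ) * Vt V' y' ξ (η * y₀)) - (1 / y₀) * ∑ V' : Fin l → Fin (m + 2), (μ (wZ V' * Zq ℓ') : ℝ) * Vt V' y' ξ (η * y₀)) ∧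
    (∀ (μ : (DrinfeldKohnoTrunc ℚ (Fin 4) N) →ₗ[ℚ] ℚ) {l : ℕ} (P Q : (DrinfeldKohnoTrunc ℚ (Fin 4) N)) (y : Fin l → ℝ) (η : ℝ), (∀ i, 0 < y i ∧ y i < 1) → 0 < η → η ≤ (β : ℝ) → ∑ V : Fin l → Fin (m + 2), (μ (P * (Zq ℓ * wZ V - wZ V * Zq ℓ) * Q) : ℝ) * Vt V y 0 η = 0) ∧
    (∀ (μ : (DrinfeldKohnoTrunc ℚ (Fin 4) N) →ₗ[ℚ] ℚ) {k : ℕ} (P Q : (DrinfeldKohnoTrunc ℚ (Fin 4) N)) (x : Fin k → ℝ) (ξ : ℝ), (∀ i, 0 < x i ∧ x i < 1) → 0 < ξ → ξ ≤ (α : ℝ) → ∑ U : Fin k → Fin (m + 2), (μ (P * (Zq ℓ' * wZ U - wZ U * Zq ℓ') * Q) : ℝ) * Ht U x ξ 0 = 0) ∧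
    (∀ (μ : (DrinfeldKohnoTrunc ℚ (Fin 4) N) →ₗ[ℚ] ℚ) (P Q : (DrinfeldKohnoTrunc ℚ (Fin 4) N)), μ (P * (Zq ℓ * Zq ℓ' - Zq ℓ' * Zq ℓ) * Q) = 0) ∧
    (∀ (μ : (DrinfeldKohnoTrunc ℚ (Fin 4) N) →ₗ[ℚ] ℚ) (P Q : (DrinfeldKohnoTrunc ℚ (Fin 4) N)) (x y : ℝ), 0 < x → x < (α : ℝ) → 0 < y → y < (β : ℝ) → ∑ a : Fin (m + 2), ∑ b : Fin (m + 2), (fd a x y * gd b x y) * (μ (P * (Zq a * Zq b - Zq b * Zq a) * Q) : ℝ) = 0) ∧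
    (∀ (μ : (DrinfeldKohnoTrunc ℚ (Fin 4) N) →ₗ[ℚ] ℚ) (P Q : (DrinfeldKohnoTrunc ℚ (Fin 4) N)) (s : ℝ), 0 < s → s < (β : ℝ) → ∑ b : Fin (m + 2), gd b 0 s * (μ (P * (Zq ℓ * Zq b - Zq b * Zq ℓ) * Q) : ℝ) = 0) ∧
    (∀ (μ : (DrinfeldKohnoTrunc ℚ (Fin 4) N) →ₗ[ℚ] ℚ) (P Q : (DrinfeldKohnoTrunc ℚ (Fin 4) N)) (t : ℝ), 0 < t → t < (α : ℝ) → ∑ a : Fin (m + 2), fd a t 0 * (μ (P * (Zq ℓ' * Zq a - Zq a * Zq ℓ') * Q) : ℝ) = 0) ∧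
    (∀ (a : Fin (m + 2)) (ξ η : ℝ), 0 ≤ ξ → ξ ≤ (α : ℝ) → 0 ≤ η → η ≤ (β : ℝ) → HasDerivAt (fun y => fd a ξ y) (dd a ξ η) η) ∧
    (∀ (b : Fin (m + 2)) (ξ η : ℝ), 0 ≤ ξ → ξ ≤ (α : ℝ) → 0 ≤ η → η ≤ (β : ℝ) → HasDerivAt (fun x => gd b x η) (dd b ξ η) ξ) ∧
    (∀ {k : ℕ} (U : Fin k → Fin (m + 2)) (x : Fin k → ℝ) (ξ η : ℝ), (∀ i, 0 ≤ x i ∧ x i ≤ 1) → 0 ≤ ξ → ξ ≤ (α : ℝ) → 0 ≤ η → η ≤ (β : ℝ) → HasDerivAt (fun t => Ht U x t η) (dHt U x ξ η) ξ) ∧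
    (∀ {l : ℕ} (V : Fin l → Fin (m + 2)) (y : Fin l → ℝ) (ξ η : ℝ), (∀ i, 0 ≤ y i ∧ y i ≤ 1) → 0 ≤ ξ → ξ ≤ (α : ℝ) → 0 ≤ η → η ≤ (β : ℝ) → HasDerivAt (fun s => Vt V y ξ s) (dVt V y ξ η) η) ∧
    (∀ {k : ℕ} (U : Fin (k + 1) → Fin (m + 2)) (x₀ : ℝ) (x' : Fin k → ℝ) (ξ η : ℝ), 0 < x₀ → x₀ < 1 → (∀ i, 0 ≤ x' i ∧ x' i ≤ 1) → 0 ≤ ξ → ξ ≤ (α : ℝ) → 0 ≤ η → η ≤ (β : ℝ) → HasDerivAt (fun t => t * Ht U (Fin.cons t x') ξ η) (ξ * dHt U (Fin.cons x₀ x') ξ η) x₀) ∧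
    (∀ {l : ℕ} (V : Fin (l + 1) → Fin (m + 2)) (y₀ : ℝ) (y' : Fin l → ℝ) (ξ η : ℝ), 0 < y₀ → y₀ < 1 → (∀ i, 0 ≤ y' i ∧ y' i ≤ 1) → 0 ≤ ξ → ξ ≤ (α : ℝ) → 0 ≤ η → η ≤ (β : ℝ) → HasDerivAt (fun t => t * Vt V (Fin.cons t y') ξ η) (η * dVt V (Fin.cons y₀ y') ξ η) y₀) ∧
    (∀ {k : ℕ} (U : Fin (k + 1) → Fin (m + 2)) (x' : Fin k → ℝ) (ξ η : ℝ), (∀ i, 0 ≤ x' i ∧ x' i ≤ 1) → 0 ≤ ξ → ξ ≤ (α : ℝ) → 0 ≤ η → η ≤ (β : ℝ) → ContinuousOn (fun t => t * Ht U (Fin.cons t x') ξ η) (Set.Icc 0 1)) ∧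
    (∀ {l : ℕ} (V : Fin (l + 1) → Fin (m + 2)) (y' : Fin l → ℝ) (ξ η : ℝ), (∀ i, 0 ≤ y' i ∧ y' i ≤ 1) → 0 ≤ ξ → ξ ≤ (α : ℝ) → 0 ≤ η → η ≤ (β : ℝ) → ContinuousOn (fun t => t * Vt V (Fin.cons t y') ξ η) (Set.Icc 0 1)) ∧
    (∀ {d : ℕ} {W : Set (Fin d → ℝ)}, IsSemialgebraic ℚ W → ∀ (a : Fin (m + 2)) {T Y : (Fin d → ℝ) → ℝ}, IsSemialgebraicFunOn ℚ W T → IsSemialgebraicFunOn ℚ W Y → IsSemialgebraicFunOn ℚ W fun z => fd a (T z) (Y z)) ∧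
    (∀ {d : ℕ} {W : Set (Fin d → ℝ)}, IsSemialgebraic ℚ W → ∀ (b : Fin (m + 2)) {T Y : (Fin d → ℝ) → ℝ}, IsSemialgebraicFunOn ℚ W T → IsSemialgebraicFunOn ℚ W Y → IsSemialgebraicFunOn ℚ W fun z => gd b (T z) (Y z)) ∧
    (∀ {d : ℕ} {W : Set (Fin d → ℝ)}, IsSemialgebraic ℚ W → ∀ (a : Fin (m + 2)) {T Y : (Fin d → ℝ) → ℝ}, IsSemialgebraicFunOn ℚ W T → IsSemialgebraicFunOn ℚ W Y → IsSemialgebraicFunOn ℚ W fun z => dd a (T z) (Y z)) ∧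
    (∀ {d : ℕ} {W : Set (Fin d → ℝ)}, IsSemialgebraic ℚ W → ∀ {n : ℕ} (U : Fin n → Fin (m + 2)) {X : (Fin d → ℝ) → Fin n → ℝ} {P Q : (Fin d → ℝ) → ℝ}, (∀ i, IsSemialgebraicFunOn ℚ W fun z => X z i) → IsSemialgebraicFunOn ℚ W P → IsSemialgebraicFunOn ℚ W Q → IsSemialgebraicFunOn ℚ W fun z => Ht U (X z) (P z) (Q z)) ∧
    (∀ {d : ℕ} {W : Set (Fin d → ℝ)}, IsSemialgebraic ℚ W → ∀ {n : ℕ} (V : Fin n → Fin (m + 2)) {Y : (Fin d → ℝ) → Fin n → ℝ} {P Q : (Fin d → ℝ) → ℝ}, (∀ i, IsSemialgebraicFunOn ℚ W fun z => Y z i) → IsSemialgebraicFunOn ℚ W P → IsSemialgebraicFunOn ℚ W Q → IsSemialgebraicFunOn ℚ W fun z => Vt V (Y z) (P z) (Q z)) ∧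
    (∀ {d : ℕ} {W : Set (Fin d → ℝ)}, IsSemialgebraic ℚ W → ∀ {n : ℕ} (U : Fin n → Fin (m + 2)) {X : (Fin d → ℝ) → Fin n → ℝ} {P Q : (Fin d → ℝ) → ℝ}, (∀ i, IsSemialgebraicFunOn ℚ W fun z => X z i) → IsSemialgebraicFunOn ℚ W P → IsSemialgebraicFunOn ℚ W Q → IsSemialgebraicFunOn ℚ W fun z => dHt U (X z) (P z) (Q z)) ∧
    (∀ {d : ℕ} {W : Set (Fin d → ℝ)}, IsSemialgebraic ℚ W → ∀ {n : ℕ} (V : Fin n → Fin (m + 2)) {Y : (Fin d → ℝ) → Fin n → ℝ} {P Q : (Fin d → ℝ) → ℝ}, (∀ i, IsSemialgebraicFunOn ℚ W fun z => Y z i) → IsSemialgebraicFunOn ℚ W P → IsSemialgebraicFunOn ℚ W Q → IsSemialgebraicFunOn ℚ W fun z => dVt V (Y z) (P z) (Q z)) ∧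
    (∃ C : ℝ, ∀ (a : Fin (m + 2)) (ξ η : ℝ), 0 ≤ ξ → ξ ≤ (α : ℝ) → 0 ≤ η → η ≤ (β : ℝ) → (a ≠ ℓ → |fd a ξ η| ≤ C) ∧ (a ≠ ℓ' → |gd a ξ η| ≤ C) ∧ |dd a ξ η| ≤ C ∧ (∀ η' : ℝ, 0 ≤ η' → η' ≤ (β : ℝ) → |fd a ξ η - fd a ξ η'| ≤ C * |η - η'|) ∧ (∀ ξ' : ℝ, 0 ≤ ξ' → ξ' ≤ (α : ℝ) → |gd a ξ η - gd a ξ' η| ≤ C * |ξ - ξ'|)) ∧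
    (∀ k : ℕ, ∃ C : ℝ, ∀ (U : Fin k → Fin (m + 2)) (x : Fin k → ℝ) (ξ η : ℝ), (∀ i, 0 ≤ x i ∧ x i ≤ 1) → 0 ≤ ξ → ξ ≤ (α : ℝ) → 0 ≤ η → η ≤ (β : ℝ) → |Ht U x ξ η| ≤ C ∧ |dHt U x ξ η| ≤ C ∧ (0 < k → |Ht U x ξ η| ≤ C * ξ) ∧ (∀ η' : ℝ, 0 ≤ η' → η' ≤ (β : ℝ) → |Ht U x ξ η - Ht U x ξ η'| ≤ C * ξ * |η - η'|)) ∧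
    (∀ l : ℕ, ∃ C : ℝ, ∀ (V : Fin l → Fin (m + 2)) (y : Fin l → ℝ) (ξ η : ℝ), (∀ i, 0 ≤ y i ∧ y i ≤ 1) → 0 ≤ ξ → ξ ≤ (α : ℝ) → 0 ≤ η → η ≤ (β : ℝ) → |Vt V y ξ η| ≤ C ∧ |dVt V y ξ η| ≤ C ∧ (0 < l → |Vt V y ξ η| ≤ C * η) ∧ (∀ ξ' : ℝ, 0 ≤ ξ' → ξ' ≤ (α : ℝ) → |Vt V y ξ η - Vt V y ξ' η| ≤ C * η * |ξ - ξ'|)))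

/-! ### Sums over the empty word and edge values of the transports -/

/-- A sum over the words of length `0` in the letters `Fin (m + 2)` is its term at the empty word
(the type of such words is a singleton). [folklore] -/
theorem edges_sum_word_nil {M : Type*} [AddCommMonoid M] (f : (Fin 0 → Fin (m + 2)) → M) :
    ∑ U, f U = f (fun i => Fin.elim0 i) := by
  rw [Fintype.sum_unique]
  exact congrArg f (Subsingleton.elim _ _)

include H in
/-- **Empty transverse block**: `B_{k,0}(ξ, η) = A_{k,0}(ξ, 0)` — both equal
`Σ_U μ(wZ U) Ht U x ξ 0` (the sum over the unique word of length `0` has `wZ nil = 1`, `Vt nil = 1`).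
[folklore] -/
theorem edges_Bf_nil (μ : (DrinfeldKohnoTrunc ℚ (Fin 4) N) →ₗ[ℚ] ℚ) {k : ℕ} (x : Fin k → ℝ)
    (y : Fin 0 → ℝ) (ξ η : ℝ) : Bf μ x y ξ η = Af μ x y ξ 0 := by
  obtain ⟨hwZ, _, _, hAf, hBf, _, _, _, _, _, _, _, hVt_nil, -⟩ := H
  rw [hAf, hBf]
  simp only [edges_sum_word_nil, hVt_nil, hwZ, List.ofFn_zero, List.map_nil, List.prod_nil, one_mul,
    mul_one]

include H in
/-- **Empty peeled block**: `A_{0,l}(ξ, η) = B_{0,l}(0, η)` — both equal `Σ_V μ(wZ V) Vt V y 0 η`.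
[folklore] -/
theorem edges_Af_nil (μ : (DrinfeldKohnoTrunc ℚ (Fin 4) N) →ₗ[ℚ] ℚ) {l : ℕ} (x : Fin 0 → ℝ)
    (y : Fin l → ℝ) (ξ η : ℝ) : Af μ x y ξ η = Bf μ x y 0 η := by
  obtain ⟨hwZ, _, _, hAf, hBf, _, _, _, _, _, _, hHt_nil, -⟩ := H
  rw [hAf, hBf]
  simp only [edges_sum_word_nil, hHt_nil, hwZ, List.ofFn_zero, List.map_nil, List.prod_nil, one_mul,
    mul_one]

include H in
/-- **Edge value** `A_{k,l+1}(ξ, 0) = 0` (every term carries `Vt V y 0 0 = 0`). [folklore] -/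
theorem edges_Af_height_zero (μ : (DrinfeldKohnoTrunc ℚ (Fin 4) N) →ₗ[ℚ] ℚ) {k l : ℕ} (x : Fin k → ℝ)
    (y : Fin (l + 1) → ℝ) (ξ : ℝ) : Af μ x y ξ 0 = 0 := by
  obtain ⟨_, _, _, hAf, _, _, _, _, _, _, _, _, _, _, _, _, hVt_zero, -⟩ := H
  rw [hAf]
  simp only [hVt_zero, mul_zero, Finset.sum_const_zero]

include H in
/-- **Edge value** `B_{k+1,l}(0, η) = 0` (every term carries `Ht U x 0 0 = 0`). [folklore] -/
theorem edges_Bf_width_zero (μ : (DrinfeldKohnoTrunc ℚ (Fin 4) N) →ₗ[ℚ] ℚ) {k l : ℕ} (x : Fin (k + 1) → ℝ)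
    (y : Fin l → ℝ) (η : ℝ) : Bf μ x y 0 η = 0 := by
  obtain ⟨_, _, _, _, hBf, _, _, _, _, _, _, _, _, _, _, hHt_zero, -⟩ := H
  rw [hBf]
  simp only [hHt_zero, mul_zero, Finset.sum_const_zero]

/-! ### The lemmas of the engine with identically vanishing or exactly decomposing integrands -/

include H in
/-- **The defect vanishes on both axes**: `F(x, y; 0, η) = 0 = F(x, y; ξ, 0)`. [folklore] -/
theorem F_axes (μ : (DrinfeldKohnoTrunc ℚ (Fin 4) N) →ₗ[ℚ] ℚ) {k l : ℕ} (x : Fin k → ℝ) (y : Fin l → ℝ) (ξ η : ℝ) :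
    F μ x y 0 η = 0 ∧ F μ x y ξ 0 = 0 := by
  have H' := H
  obtain ⟨_, _, _, hAf, hBf, _, _, hF, _, _, _, _, _, _, _, hHt_zero, hVt_zero, -⟩ := H'
  refine ⟨?_, ?_⟩
  · rw [hF, sub_eq_zero]
    cases k with
    | zero => exact edges_Af_nil H μ x y 0 η
    | succ k =>
      rw [hAf, hBf]
      simp only [hHt_zero, zero_mul, mul_zero, Finset.sum_const_zero]
  · rw [hF, sub_eq_zero]
    cases l with
    | zero => exact (edges_Bf_nil H μ x y ξ 0).symm
    | succ l =>
      rw [hAf, hBf]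
      simp only [hVt_zero, zero_mul, mul_zero, Finset.sum_const_zero]

include H in
/-- **Edge decomposition, interior indices** (`k, l ≥ 1`). [folklore] -/
theorem decomp_mid (μ : (DrinfeldKohnoTrunc ℚ (Fin 4) N) →ₗ[ℚ] ℚ) (k l e : ℕ) (Ξ Η σ : (Fin e → ℝ) → ℝ)
    (R : KZ.IntegralRep (k + 1 + (l + 1) + e)) (hRd : R.domain = KZ.cube (k + 1 + (l + 1) + e))
    (hRi : EqOn R.integrand (fun z => σ (Θb (k + 1) (l + 1) e z) *
      F μ (Xb (k + 1) (l + 1) e z) (Yb (k + 1) (l + 1) e z) (Ξ (Θb (k + 1) (l + 1) e z)) (Η (Θb (k + 1) (l + 1) e z)))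
      (KZ.cube (k + 1 + (l + 1) + e)))
    (RA RB : KZ.IntegralRep (k + 1 + (l + 1) + e))
    (hRAd : RA.domain = KZ.cube (k + 1 + (l + 1) + e)) (hRBd : RB.domain = KZ.cube (k + 1 + (l + 1) + e))
    (hRAi : RA.integrand = fun z => σ (Θb (k + 1) (l + 1) e z) *
      (Af μ (Xb (k + 1) (l + 1) e z) (Yb (k + 1) (l + 1) e z) (Ξ (Θb (k + 1) (l + 1) e z)) (Η (Θb (k + 1) (l + 1) e z)) -
        Af μ (Xb (k + 1) (l + 1) e z) (Yb (k + 1) (l + 1) e z) (Ξ (Θb (k + 1) (l + 1) e z)) 0))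
    (hRBi : RB.integrand = fun z => σ (Θb (k + 1) (l + 1) e z) *
      (Bf μ (Xb (k + 1) (l + 1) e z) (Yb (k + 1) (l + 1) e z) (Ξ (Θb (k + 1) (l + 1) e z)) (Η (Θb (k + 1) (l + 1) e z)) -
        Bf μ (Xb (k + 1) (l + 1) e z) (Yb (k + 1) (l + 1) e z) 0 (Η (Θb (k + 1) (l + 1) e z)))) :
    KZ.toPeriodAlgebra (KZ.toFormalPeriod (KZ.of R)) =
      KZ.toPeriodAlgebra (KZ.toFormalPeriod (KZ.of RA)) - KZ.toPeriodAlgebra (KZ.toFormalPeriod (KZ.of RB)) := by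
  have H' := H
  obtain ⟨_, _, _, _, _, _, _, hF, -⟩ := H'
  refine CornerReps.cls_sub (hRAd.trans hRd.symm) (hRBd.trans hRd.symm) fun z hz => ?_
  rw [hRd] at hz
  simp only [Pi.sub_apply, hRi hz, hRAi, hRBi, hF, edges_Af_height_zero H, edges_Bf_width_zero H,
    sub_zero, mul_sub]

include H in
/-- **Edge decomposition, `l = 0`**: `F_{k+1,0} = A(Ξ,Η) − A(Ξ,0)`. [folklore] -/
theorem decomp_right (μ : (DrinfeldKohnoTrunc ℚ (Fin 4) N) →ₗ[ℚ] ℚ) (k e : ℕ) (Ξ Η σ : (Fin e → ℝ) → ℝ)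
    (R : KZ.IntegralRep (k + 1 + 0 + e)) (hRd : R.domain = KZ.cube (k + 1 + 0 + e))
    (hRi : EqOn R.integrand (fun z => σ (Θb (k + 1) 0 e z) *
      F μ (Xb (k + 1) 0 e z) (Yb (k + 1) 0 e z) (Ξ (Θb (k + 1) 0 e z)) (Η (Θb (k + 1) 0 e z)))
      (KZ.cube (k + 1 + 0 + e)))
    (RA : KZ.IntegralRep (k + 1 + 0 + e)) (hRAd : RA.domain = KZ.cube (k + 1 + 0 + e))
    (hRAi : RA.integrand = fun z => σ (Θb (k + 1) 0 e z) *
      (Af μ (Xb (k + 1) 0 e z) (Yb (k + 1) 0 e z) (Ξ (Θb (k + 1) 0 e z)) (Η (Θb (k + 1) 0 e z)) -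
        Af μ (Xb (k + 1) 0 e z) (Yb (k + 1) 0 e z) (Ξ (Θb (k + 1) 0 e z)) 0)) :
    KZ.toPeriodAlgebra (KZ.toFormalPeriod (KZ.of R)) = KZ.toPeriodAlgebra (KZ.toFormalPeriod (KZ.of RA)) := by
  have H' := H
  obtain ⟨_, _, _, _, _, _, _, hF, -⟩ := H'
  refine CornerReps.cls_congr (hRAd.trans hRd.symm) fun z hz => ?_
  rw [hRd] at hz
  simp only [hRi hz, hRAi, hF, edges_Bf_nil H]

include H in
/-- **Edge decomposition, `k = 0`**: `F_{0,l+1} = −(B(Ξ,Η) − B(0,Η))`. [folklore] -/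
theorem decomp_left (μ : (DrinfeldKohnoTrunc ℚ (Fin 4) N) →ₗ[ℚ] ℚ) (l e : ℕ) (Ξ Η σ : (Fin e → ℝ) → ℝ)
    (R : KZ.IntegralRep (0 + (l + 1) + e)) (hRd : R.domain = KZ.cube (0 + (l + 1) + e))
    (hRi : EqOn R.integrand (fun z => σ (Θb 0 (l + 1) e z) *
      F μ (Xb 0 (l + 1) e z) (Yb 0 (l + 1) e z) (Ξ (Θb 0 (l + 1) e z)) (Η (Θb 0 (l + 1) e z)))
      (KZ.cube (0 + (l + 1) + e)))
    (RB : KZ.IntegralRep (0 + (l + 1) + e)) (hRBd : RB.domain = KZ.cube (0 + (l + 1) + e))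
    (hRBi : RB.integrand = fun z => σ (Θb 0 (l + 1) e z) *
      (Bf μ (Xb 0 (l + 1) e z) (Yb 0 (l + 1) e z) (Ξ (Θb 0 (l + 1) e z)) (Η (Θb 0 (l + 1) e z)) -
        Bf μ (Xb 0 (l + 1) e z) (Yb 0 (l + 1) e z) 0 (Η (Θb 0 (l + 1) e z)))) :
    KZ.toPeriodAlgebra (KZ.toFormalPeriod (KZ.of R)) = - KZ.toPeriodAlgebra (KZ.toFormalPeriod (KZ.of RB)) := by
  have H' := H
  obtain ⟨_, _, _, _, _, _, _, hF, -⟩ := H'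
  -- the zero representation on the cube
  set Z : KZ.IntegralRep (0 + (l + 1) + e) := ⟨KZ.cube _, fun _ => 0, KZ.isSemialgebraic_cube,
    (isSemialgebraicFunOn_aeval KZ.isSemialgebraic_cube (0 : MvPolynomial (Fin (0 + (l + 1) + e)) ℚ)).congr
      (fun _ _ => by simp), integrableOn_zero⟩
  have hZ0 : KZ.toPeriodAlgebra (KZ.toFormalPeriod (KZ.of Z)) = 0 :=
    CornerReps.cls_eq_zero_of_eqOn_zero Z fun _ _ => rfl
  have hadd : KZ.toPeriodAlgebra (KZ.toFormalPeriod (KZ.of Z)) =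
      KZ.toPeriodAlgebra (KZ.toFormalPeriod (KZ.of R)) + KZ.toPeriodAlgebra (KZ.toFormalPeriod (KZ.of RB)) := by
    refine CornerReps.cls_add (r := Z) hRd hRBd fun z hz => ?_
    change z ∈ KZ.cube (0 + (l + 1) + e) at hz
    change (0 : ℝ) = R.integrand z + RB.integrand z
    simp only [hRi hz, hRBi, hF, edges_Af_nil H]
    ring
  rw [hZ0] at hadd
  exact eq_neg_of_add_eq_zero_left hadd.symm

include H in
/-- **Base of the induction**: in degree `0` the defect vanishes identically
(`F_{0,0} = μ(1)·1·1 − μ(1)·1·1`). [folklore] -/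
theorem decomp_zero (μ : (DrinfeldKohnoTrunc ℚ (Fin 4) N) →ₗ[ℚ] ℚ) (e : ℕ) (Ξ Η σ : (Fin e → ℝ) → ℝ)
    (R : KZ.IntegralRep (0 + 0 + e)) (hRd : R.domain = KZ.cube (0 + 0 + e))
    (hRi : EqOn R.integrand (fun z => σ (Θb 0 0 e z) *
      F μ (Xb 0 0 e z) (Yb 0 0 e z) (Ξ (Θb 0 0 e z)) (Η (Θb 0 0 e z))) (KZ.cube (0 + 0 + e))) :
    KZ.toPeriodAlgebra (KZ.toFormalPeriod (KZ.of R)) = 0 := by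
  obtain ⟨_, _, _, hAf, hBf, _, _, hF, _, _, _, hHt_nil, hVt_nil, -⟩ := H
  refine CornerReps.cls_eq_zero_of_eqOn_zero R fun z hz => ?_
  rw [hRd] at hz
  simp only [hRi hz, hF, hAf, hBf, edges_sum_word_nil, hHt_nil, hVt_nil, mul_one, sub_self, mul_zero,
    Pi.zero_apply]

include H in
/-- **Step A.3, empty transverse block**: in degree `k + 0` the `dB`-term vanishes identically
(`dVt` of the empty word is `0`). [folklore] -/
theorem stepA_euler_nil (μ : (DrinfeldKohnoTrunc ℚ (Fin 4) N) →ₗ[ℚ] ℚ) (k e : ℕ) (a : Fin (m + 2))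
    (Ξ₂ Η₂ ρ₂ : (Fin (e + 2) → ℝ) → ℝ)
    (W₂ : KZ.IntegralRep (k + 0 + (e + 2))) (hW₂d : W₂.domain = KZ.cube (k + 0 + (e + 2)))
    (hW₂i : W₂.integrand = fun w => ρ₂ (Θb k 0 (e + 2) w) *
      (fd a (Ξ₂ (Θb k 0 (e + 2) w)) (Η₂ (Θb k 0 (e + 2) w)) *
        dBf (μ ∘ₗ op a) (Xb k 0 (e + 2) w) (Yb k 0 (e + 2) w) (Ξ₂ (Θb k 0 (e + 2) w)) (Η₂ (Θb k 0 (e + 2) w)))) :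
    KZ.toPeriodAlgebra (KZ.toFormalPeriod (KZ.of W₂)) = 0 := by
  obtain ⟨_, _, _, _, _, _, hdBf, _, _, _, _, _, _, _, hdVt_nil, -⟩ := H
  refine CornerReps.cls_eq_zero_of_eqOn_zero W₂ ?_
  rw [hW₂d]
  intro w _
  simp only [hW₂i, hdBf, hdVt_nil, zero_mul, mul_zero, Finset.sum_const_zero, Pi.zero_apply]

include H in
/-- **Step A.4, empty transverse block** (regularised letter `ℓ`): in degree `k + 0` the height
difference vanishes identically (`B_{k,0}` does not depend on the height, nor does `fd_ℓ = 1/t`).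
[folklore] -/
theorem stepA_direct_nil (μ : (DrinfeldKohnoTrunc ℚ (Fin 4) N) →ₗ[ℚ] ℚ) (k e : ℕ)
    (Ξ₁ Η₁ ρ : (Fin (e + 1) → ℝ) → ℝ)
    (Q : KZ.IntegralRep (k + 0 + (e + 1))) (hQd : Q.domain = KZ.cube (k + 0 + (e + 1)))
    (hQi : Q.integrand = fun w => ρ (Θb k 0 (e + 1) w) *
      (fd ℓ (Ξ₁ (Θb k 0 (e + 1) w)) (Η₁ (Θb k 0 (e + 1) w)) *
          Bf (μ ∘ₗ op ℓ) (Xb k 0 (e + 1) w) (Yb k 0 (e + 1) w) (Ξ₁ (Θb k 0 (e + 1) w)) (Η₁ (Θb k 0 (e + 1) w)) -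
        fd ℓ (Ξ₁ (Θb k 0 (e + 1) w)) 0 *
          Bf (μ ∘ₗ op ℓ) (Xb k 0 (e + 1) w) (Yb k 0 (e + 1) w) (Ξ₁ (Θb k 0 (e + 1) w)) 0)) :
    KZ.toPeriodAlgebra (KZ.toFormalPeriod (KZ.of Q)) = 0 := by
  have H' := H
  obtain ⟨_, _, _, _, _, _, _, _, _, _, _, _, _, _, _, _, _, hfd_reg, -⟩ := H'
  refine CornerReps.cls_eq_zero_of_eqOn_zero Q ?_
  rw [hQd]
  intro w _
  simp only [hQi, hfd_reg, edges_Bf_nil H, sub_self, mul_zero, Pi.zero_apply]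

include H in
/-- **Degree `n − 1`, the other regularised letter**: the `dd_{ℓ'}`-term of Step A vanishes
(`dd_{ℓ'} ≡ 0`). [folklore] -/
theorem collect_deg1_zero (μ : (DrinfeldKohnoTrunc ℚ (Fin 4) N) →ₗ[ℚ] ℚ) (k l e : ℕ) (Ξ₂ Η₂ ρ₂ : (Fin (e + 2) → ℝ) → ℝ)
    (W₁ : KZ.IntegralRep (k + l + (e + 2))) (hW₁d : W₁.domain = KZ.cube (k + l + (e + 2)))
    (hW₁i : W₁.integrand = fun w => ρ₂ (Θb k l (e + 2) w) *
      (dd ℓ' (Ξ₂ (Θb k l (e + 2) w)) (Η₂ (Θb k l (e + 2) w)) *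
        Bf (μ ∘ₗ op ℓ') (Xb k l (e + 2) w) (Yb k l (e + 2) w) (Ξ₂ (Θb k l (e + 2) w)) (Η₂ (Θb k l (e + 2) w)))) :
    KZ.toPeriodAlgebra (KZ.toFormalPeriod (KZ.of W₁)) = 0 := by
  obtain ⟨_, _, _, _, _, _, _, _, _, _, _, _, _, _, _, _, _, _, _, _, hdd_reg', -⟩ := H
  refine CornerReps.cls_eq_zero_of_eqOn_zero W₁ ?_
  rw [hW₁d]
  intro w _
  simp only [hW₁i, hdd_reg', zero_mul, mul_zero, Pi.zero_apply]

end AbstractEngine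

/-- **Hook `cornerEngineEdges_hook`** (registered form of `edges_sum_word_nil`): a sum over the
words of length `0` in the letters `Fin (m + 2)` is its term at the empty word. [folklore] -/
theorem cornerEngineEdges_hook : ∀ (M : Type) [AddCommMonoid M] (m : ℕ) (f : (Fin 0 → Fin (m + 2)) → M), ∑ U, f U = f (fun i => Fin.elim0 i) :=
  fun _ _ _ f => edges_sum_word_nil f

end Summit.KontsevichZagierPeriods.FurushoPentagon.PentagonInKZ
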